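import Summits.HubbardSuperconductivity.HubbardSuperconductivity.Theorems.BalabanIRBirBdGPhaseCoercivitySymbolSum

/-!
# Route BalabanIR — crux 3 `BirBdGPhaseCoercivity` (item `stmt-HubbardSuperconductivity-2081`):
# XII. The symbol inequality from a trigonometric approximant of the inverse quasiparticle energy

THEOREM (`symbolIneq_of_trigApprox`, fixed side `L`). Let `Δ_k = Σ_{r∈B} c_r χ_r(k)` on the grid
(`|r|_∞ ≤ 1` on `B`), `E_k > 0`, and let `m(k) = Σ_ρ a_ρ χ_ρ(k)` be a trigonometric multiplier of
coordinate degree `≤ D` with `L ≥ D + 3`. If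
  (A) `|E_k⁻¹ - m(k)| ≤ δ` on the grid,
  (T) `κ ε(q) ≤ Re Σ_{r,r'∈B} c_r conj(c_{r'}) w_{rr'}(q) a_{r'-r}` on the grid, and
  (K) `2c₀ + 6 (Σ_r |c_r|)² δ ≤ κ`,
then the one-loop symbol inequality (★)_L of `BirBdG.coercive_of_symbolIneq` holds with constant `c₀`:
`2c₀ L² ε(q) ≤ Σ_k N(k,q)/E_k` for every `q` — because `Σ_k N m = L² Σ c c̄' w a` exactly (file XI),
`|Σ_k N (E⁻¹ - m)| ≤ δ Σ_k |N| ≤ 6δ(Σ|c|)² L² ε(q)` (`abs_numerator_le`), and `N` is real.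
This is the deterministic core of the proof scheme for (★) recorded on the item
(`Prover1_2081_symbol_inequality_proof_scheme.md`): per parameter point it remains to supply the
approximant `a` with (A) (a one-variable polynomial in `E²` does it) and the degree-2 trigonometric
inequality (T).

References: the evidence notes on the item; Friedli–Velenik 2017, §10.4. No definition is introduced.
-/

noncomputable section

namespace Summit.HubbardSuperconductivity.HubbardSuperconductivity.Theorems

namespace BirBdG

open Matrix Finset Literature.Probability.LatticeModels
open scoped ComplexConjugate

variable {L : ℕ} [NeZero L]

/-! ### The second-order bound on the numerator -/

/-- The weights are nonnegative and second order: `0 ≤ w_{rr'}(q) ≤ 6 ε(q)` for `|r|_∞, |r'|_∞ ≤ 1`. [folklore] -/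
theorem weight_nonneg_and_le {r r' : ℤ × ℤ} (hr : |r.1| ≤ 1 ∧ |r.2| ≤ 1) (hr' : |r'.1| ≤ 1 ∧ |r'.2| ≤ 1)
    (θ₀ θ₁ : ℝ) :
    0 ≤ (3 - Real.cos (r.1 * θ₀ + r.2 * θ₁) - Real.cos (r'.1 * θ₀ + r'.2 * θ₁)
          - Real.cos ((r.1 - r'.1) * θ₀ + (r.2 - r'.2) * θ₁)) / 2 ∧
      (3 - Real.cos (r.1 * θ₀ + r.2 * θ₁) - Real.cos (r'.1 * θ₀ + r'.2 * θ₁)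
          - Real.cos ((r.1 - r'.1) * θ₀ + (r.2 - r'.2) * θ₁)) / 2 ≤
        6 * (4 - 2 * Real.cos θ₀ - 2 * Real.cos θ₁) := by
  have h1 := one_sub_cos_freq_le (s := r) (by linarith [hr.1]) (by linarith [hr.2]) θ₀ θ₁
  have h2 := one_sub_cos_freq_le (s := r') (by linarith [hr'.1]) (by linarith [hr'.2]) θ₀ θ₁
  have h3 := one_sub_cos_freq_le (s := r - r')
    (by simp only [Prod.fst_sub]; have := abs_sub (r.1) (r'.1); linarith [hr.1, hr'.1])
    (by simp only [Prod.snd_sub]; have := abs_sub (r.2) (r'.2); linarith [hr.2, hr'.2]) θ₀ θ₁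
  simp only [Prod.fst_sub, Prod.snd_sub, Int.cast_sub] at h3
  constructor
  · linarith [Real.cos_le_one (r.1 * θ₀ + r.2 * θ₁), Real.cos_le_one (r'.1 * θ₀ + r'.2 * θ₁),
      Real.cos_le_one ((r.1 - r'.1) * θ₀ + (r.2 - r'.2) * θ₁)]
  · linarith

/-- **Second-order bound on the one-loop numerator**: if `Δ_k = Σ_{r∈B} c_r χ_r(k)` with `|r|_∞ ≤ 1`
on `B`, then `|N(k,q)| ≤ 6 ε(q) (Σ_{r∈B} |c_r|)²`. [folklore] -/
theorem abs_numerator_le (B : Finset (ℤ × ℤ)) (hB : ∀ r ∈ B, |r.1| ≤ 1 ∧ |r.2| ≤ 1)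
    (c : ℤ × ℤ → ℂ) (Δ : TorusSite 2 L → ℂ)
    (hΔ : ∀ k, Δ k = ∑ r ∈ B, c r * torusChar (![((r.1 : ℤ) : ZMod L), ((r.2 : ℤ) : ZMod L)] : TorusSite 2 L) k)
    (k q : TorusSite 2 L) :
    |2 * ‖Δ k‖ ^ 2 - (‖Δ k + Δ (k + q)‖ ^ 2 + ‖Δ k + Δ (k - q)‖ ^ 2) / 4| ≤
      6 * (4 - 2 * Real.cos (latticeMomentum L q 0) - 2 * Real.cos (latticeMomentum L q 1)) *
        (∑ r ∈ B, ‖c r‖) ^ 2 := by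
  have h := numerator_eq_sum_sum B c Δ hΔ k q
  have hnorm : |2 * ‖Δ k‖ ^ 2 - (‖Δ k + Δ (k + q)‖ ^ 2 + ‖Δ k + Δ (k - q)‖ ^ 2) / 4| =
      ‖(((2 * ‖Δ k‖ ^ 2 - (‖Δ k + Δ (k + q)‖ ^ 2 + ‖Δ k + Δ (k - q)‖ ^ 2) / 4 : ℝ)) : ℂ)‖ := by
    rw [Complex.norm_real, Real.norm_eq_abs]
  rw [hnorm, h, sq, Finset.sum_mul_sum, Finset.mul_sum]
  refine (norm_sum_le _ _).trans (Finset.sum_le_sum fun r hr => ?_)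
  rw [Finset.mul_sum]
  refine (norm_sum_le _ _).trans (Finset.sum_le_sum fun r' hr' => ?_)
  obtain ⟨hw0, hw⟩ := weight_nonneg_and_le (hB r hr) (hB r' hr') (latticeMomentum L q 0) (latticeMomentum L q 1)
  rw [norm_mul, norm_mul, norm_mul, norm_mul, Complex.norm_conj, norm_torusChar, Complex.norm_conj,
    norm_torusChar, mul_one, mul_one, Complex.norm_real, Real.norm_eq_abs, abs_of_nonneg hw0]
  have hc : 0 ≤ ‖c r‖ * ‖c r'‖ := mul_nonneg (norm_nonneg _) (norm_nonneg _)
  calc ‖c r‖ * ‖c r'‖ * ((3 - Real.cos (r.1 * latticeMomentum L q 0 + r.2 * latticeMomentum L q 1)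
          - Real.cos (r'.1 * latticeMomentum L q 0 + r'.2 * latticeMomentum L q 1)
          - Real.cos ((r.1 - r'.1) * latticeMomentum L q 0 + (r.2 - r'.2) * latticeMomentum L q 1)) / 2)
      ≤ ‖c r‖ * ‖c r'‖ * (6 * (4 - 2 * Real.cos (latticeMomentum L q 0) - 2 * Real.cos (latticeMomentum L q 1))) :=
        mul_le_mul_of_nonneg_left hw hc
    _ = 6 * (4 - 2 * Real.cos (latticeMomentum L q 0) - 2 * Real.cos (latticeMomentum L q 1)) *
          (‖c r‖ * ‖c r'‖) := by ring

/-! ### The symbol inequality from a trigonometric approximant -/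

/-- **(★) at side `L` from a trigonometric approximant of `1/E`.** See the module docstring:
hypotheses (A) approximation on the grid, (T) the degree-2 trigonometric inequality for the low
coefficients of the approximant, (K) the constant bookkeeping; conclusion: the one-loop symbol
inequality with constant `c₀` for every texture momentum `q` (the hypothesis `hsym` of
`BirBdG.coercive_of_symbolIneq`, for a general bond expansion `Δ_k = Σ_{r∈B} c_r χ_r(k)`). [folklore] -/
theorem symbolIneq_of_trigApprox (B : Finset (ℤ × ℤ)) (hB : ∀ r ∈ B, |r.1| ≤ 1 ∧ |r.2| ≤ 1)
    (c : ℤ × ℤ → ℂ) (Δ : TorusSite 2 L → ℂ)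
    (hΔ : ∀ k, Δ k = ∑ r ∈ B, c r * torusChar (![((r.1 : ℤ) : ZMod L), ((r.2 : ℤ) : ZMod L)] : TorusSite 2 L) k)
    (E : TorusSite 2 L → ℝ) (hEpos : ∀ k, 0 < E k)
    (a : (ℤ × ℤ) →₀ ℂ) (D : ℕ) (hsupp : ∀ ρ ∈ a.support, |ρ.1| ≤ D ∧ |ρ.2| ≤ D) (hL : D + 3 ≤ L)
    (c₀ κ δ : ℝ)
    (hA : ∀ k : TorusSite 2 L, ‖(((E k)⁻¹ : ℝ) : ℂ) -
      ∑ ρ ∈ a.support, a ρ * torusChar (![((ρ.1 : ℤ) : ZMod L), ((ρ.2 : ℤ) : ZMod L)] : TorusSite 2 L) k‖ ≤ δ)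
    (hT : ∀ q : TorusSite 2 L,
      κ * (4 - 2 * Real.cos (latticeMomentum L q 0) - 2 * Real.cos (latticeMomentum L q 1)) ≤
        (∑ r ∈ B, ∑ r' ∈ B, c r * conj (c r') *
          (((3 - Real.cos (r.1 * latticeMomentum L q 0 + r.2 * latticeMomentum L q 1)
            - Real.cos (r'.1 * latticeMomentum L q 0 + r'.2 * latticeMomentum L q 1)
            - Real.cos ((r.1 - r'.1) * latticeMomentum L q 0 + (r.2 - r'.2) * latticeMomentum L q 1)) / 2 : ℝ) : ℂ) *
          a (r' - r)).re)
    (hκ : 2 * c₀ + 6 * (∑ r ∈ B, ‖c r‖) ^ 2 * δ ≤ κ) (q : TorusSite 2 L) :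
    2 * c₀ * ((L ^ 2 : ℕ) : ℝ) *
        (4 - 2 * Real.cos (latticeMomentum L q 0) - 2 * Real.cos (latticeMomentum L q 1)) ≤
      ∑ k, (2 * ‖Δ k‖ ^ 2 / E k -
        (‖Δ k + Δ (k + q)‖ ^ 2 + ‖Δ k + Δ (k - q)‖ ^ 2) / (4 * E k)) := by
  -- abbreviations: ε(q), the numerator N k, the multiplier m k
  set ε : ℝ := 4 - 2 * Real.cos (latticeMomentum L q 0) - 2 * Real.cos (latticeMomentum L q 1) with hε
  have hε0 : 0 ≤ ε := by
    rw [hε]; linarith [Real.cos_le_one (latticeMomentum L q 0), Real.cos_le_one (latticeMomentum L q 1)]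
  set N : TorusSite 2 L → ℝ := fun k =>
    2 * ‖Δ k‖ ^ 2 - (‖Δ k + Δ (k + q)‖ ^ 2 + ‖Δ k + Δ (k - q)‖ ^ 2) / 4 with hN
  set m : TorusSite 2 L → ℂ := fun k =>
    ∑ ρ ∈ a.support, a ρ * torusChar (![((ρ.1 : ℤ) : ZMod L), ((ρ.2 : ℤ) : ZMod L)] : TorusSite 2 L) k with hm
  -- the summand is `N k / E k = N k · Re m k + N k · Re (E⁻¹ - m k)`
  have hsummand : ∀ k, 2 * ‖Δ k‖ ^ 2 / E k - (‖Δ k + Δ (k + q)‖ ^ 2 + ‖Δ k + Δ (k - q)‖ ^ 2) / (4 * E k) =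
      N k * (m k).re + N k * ((((E k)⁻¹ : ℝ) : ℂ) - m k).re := by
    intro k
    have hk := (hEpos k).ne'
    rw [← mul_add, Complex.sub_re, Complex.ofReal_re, add_sub_cancel, hN]
    field_simp
  simp_rw [hsummand]
  rw [Finset.sum_add_distrib]
  -- Part 1: the exact evaluation
  have hexact := sum_numerator_mul_trigPoly B hB c Δ hΔ a D hsupp hL q
  have hpart1 : ∑ k, N k * (m k).re = ((L ^ 2 : ℕ) : ℝ) *
      (∑ r ∈ B, ∑ r' ∈ B, c r * conj (c r') *
          (((3 - Real.cos (r.1 * latticeMomentum L q 0 + r.2 * latticeMomentum L q 1)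
            - Real.cos (r'.1 * latticeMomentum L q 0 + r'.2 * latticeMomentum L q 1)
            - Real.cos ((r.1 - r'.1) * latticeMomentum L q 0 + (r.2 - r'.2) * latticeMomentum L q 1)) / 2 : ℝ) : ℂ) *
          a (r' - r)).re := by
    have h1 : ∀ k, N k * (m k).re = (((N k : ℝ) : ℂ) * m k).re := fun k => by
      rw [Complex.re_ofReal_mul]
    simp_rw [h1]
    rw [← Complex.re_sum]
    change (∑ k : TorusSite 2 L, (((2 * ‖Δ k‖ ^ 2 - (‖Δ k + Δ (k + q)‖ ^ 2 + ‖Δ k + Δ (k - q)‖ ^ 2) / 4 : ℝ)) : ℂ) *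
      m k).re = _
    rw [hexact]
    have hcast : ((L : ℂ) ^ 2) = ((((L ^ 2 : ℕ) : ℝ)) : ℂ) := by push_cast; ring
    rw [hcast, Complex.re_ofReal_mul]
  -- Part 2: the approximation error
  have hpart2 : |∑ k, N k * ((((E k)⁻¹ : ℝ) : ℂ) - m k).re| ≤
      ((L ^ 2 : ℕ) : ℝ) * (6 * ε * (∑ r ∈ B, ‖c r‖) ^ 2 * δ) := by
    refine (Finset.abs_sum_le_sum_abs _ _).trans ?_
    have hterm : ∀ k ∈ (Finset.univ : Finset (TorusSite 2 L)),
        |N k * ((((E k)⁻¹ : ℝ) : ℂ) - m k).re| ≤ 6 * ε * (∑ r ∈ B, ‖c r‖) ^ 2 * δ := by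
      intro k _
      rw [abs_mul]
      have hNk := abs_numerator_le B hB c Δ hΔ k q
      have hre : |((((E k)⁻¹ : ℝ) : ℂ) - m k).re| ≤ δ :=
        (Complex.abs_re_le_norm _).trans (hA k)
      calc |N k| * |((((E k)⁻¹ : ℝ) : ℂ) - m k).re| ≤ (6 * ε * (∑ r ∈ B, ‖c r‖) ^ 2) * δ :=
            mul_le_mul hNk hre (abs_nonneg _) (by positivity)
        _ = 6 * ε * (∑ r ∈ B, ‖c r‖) ^ 2 * δ := by ring
    refine (Finset.sum_le_sum hterm).trans ?_
    rw [Finset.sum_const, Finset.card_univ, nsmul_eq_mul]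
    have hcard : (Fintype.card (TorusSite 2 L) : ℝ) = ((L ^ 2 : ℕ) : ℝ) := by
      rw [Fintype.card_fun, ZMod.card, Fintype.card_fin]
    rw [hcard]
  -- combine
  have h2 := neg_le_of_abs_le hpart2
  have h1 : ((L ^ 2 : ℕ) : ℝ) * (κ * ε) ≤ ∑ k, N k * (m k).re := by
    rw [hpart1]
    exact mul_le_mul_of_nonneg_left (hT q) (by positivity)
  have hL2 : 0 ≤ ((L ^ 2 : ℕ) : ℝ) := by positivity
  have hkey : 2 * c₀ * ε ≤ κ * ε - 6 * ε * (∑ r ∈ B, ‖c r‖) ^ 2 * δ := by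
    have := mul_le_mul_of_nonneg_right hκ hε0
    nlinarith
  calc 2 * c₀ * ((L ^ 2 : ℕ) : ℝ) * ε = ((L ^ 2 : ℕ) : ℝ) * (2 * c₀ * ε) := by ring
    _ ≤ ((L ^ 2 : ℕ) : ℝ) * (κ * ε - 6 * ε * (∑ r ∈ B, ‖c r‖) ^ 2 * δ) :=
        mul_le_mul_of_nonneg_left hkey hL2
    _ = ((L ^ 2 : ℕ) : ℝ) * (κ * ε) + -(((L ^ 2 : ℕ) : ℝ) * (6 * ε * (∑ r ∈ B, ‖c r‖) ^ 2 * δ)) := by ring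
    _ ≤ ∑ k, N k * (m k).re + ∑ k, N k * ((((E k)⁻¹ : ℝ) : ℂ) - m k).re := add_le_add h1 h2

/-! ### The `d+id` instance -/

/-- The crux's gap function on the grid as a character sum over the eight bond vectors. [folklore] -/
theorem gap_grid_eq_sum (Δ₁ Δ₂ : ℝ) (k : TorusSite 2 L) :
    ((2 * Δ₁ * (Real.cos (latticeMomentum L k 0) - Real.cos (latticeMomentum L k 1)) : ℝ) : ℂ) -
        4 * Complex.I * ((Δ₂ * Real.sin (latticeMomentum L k 0) * Real.sin (latticeMomentum L k 1) : ℝ) : ℂ) =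
      ∑ r ∈ ({(1, 0), (-1, 0), (0, 1), (0, -1), (1, 1), (-1, -1), (1, -1), (-1, 1)} : Finset (ℤ × ℤ)), (fun r : ℤ × ℤ => if (r = (1, 0) ∨ r = (-1, 0)) then (Δ₁ : ℂ) else if (r = (0, 1) ∨ r = (0, -1)) then -(Δ₁ : ℂ)
          else if (r = (1, 1) ∨ r = (-1, -1)) then Complex.I * (Δ₂ : ℂ) else -(Complex.I * (Δ₂ : ℂ))) r * torusChar (![((r.1 : ℤ) : ZMod L), ((r.2 : ℤ) : ZMod L)] : TorusSite 2 L) k := by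
  rw [gap_eq_sum_bondCoeff_mul_exp]
  refine Finset.sum_congr rfl fun r _ => ?_
  rw [torusChar_intFreq_eq_exp]

/-- `Σ_{r∈B} |c_r| = 4|Δ₁| + 4|Δ₂|` for the `d+id` bond data. [folklore] -/
theorem sum_norm_bondCoeff (Δ₁ Δ₂ : ℝ) :
    ∑ r ∈ ({(1, 0), (-1, 0), (0, 1), (0, -1), (1, 1), (-1, -1), (1, -1), (-1, 1)} : Finset (ℤ × ℤ)), ‖(fun r : ℤ × ℤ => if (r = (1, 0) ∨ r = (-1, 0)) then (Δ₁ : ℂ) else if (r = (0, 1) ∨ r = (0, -1)) then -(Δ₁ : ℂ)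
          else if (r = (1, 1) ∨ r = (-1, -1)) then Complex.I * (Δ₂ : ℂ) else -(Complex.I * (Δ₂ : ℂ))) r‖ = 4 * |Δ₁| + 4 * |Δ₂| := by
  rw [Finset.sum_insert (by decide), Finset.sum_insert (by decide), Finset.sum_insert (by decide),
    Finset.sum_insert (by decide), Finset.sum_insert (by decide), Finset.sum_insert (by decide),
    Finset.sum_insert (by decide), Finset.sum_singleton]
  simp only [Prod.mk.injEq, and_true, true_or, or_true, if_true, if_false, and_false, or_false,
    false_or, one_ne_zero, zero_ne_one, neg_eq_zero, Int.reduceNeg]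
  norm_num [Complex.norm_real, Real.norm_eq_abs, Complex.norm_I]
  ring

/-- The bond vectors of the `d+id` data have coordinates of absolute value `≤ 1`. [folklore] -/
theorem bonds_abs_le_one : ∀ r ∈ ({(1, 0), (-1, 0), (0, 1), (0, -1), (1, 1), (-1, -1), (1, -1), (-1, 1)} : Finset (ℤ × ℤ)), |r.1| ≤ 1 ∧ |r.2| ≤ 1 :=
  fun _ hr => abs_le_one_of_mem_bonds hr

/-- **(★) at side `L` for the crux's `d+id` data from a trigonometric approximant of `1/E`**:
specialisation of `symbolIneq_of_trigApprox` to `Δ_k = 2Δ₁(cos p₀ - cos p₁) - 4iΔ₂ sin p₀ sin p₁`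
(the function `Δ` of `BirBdG.coercive_of_symbolIneq`), with the constant bookkeeping
`2c₀ + 96(|Δ₁|+|Δ₂|)² δ ≤ κ`. Together with `coercive_of_symbolIneq` it proves the conclusion of
`BirBdGPhaseCoercivity` at `(μ,Δ₁,Δ₂)` on every torus of side `L ≥ D + 3` from the finite-dimensional
data (A), (T). [folklore] -/
theorem symbolIneq_dplusid_of_trigApprox (Δ₁ Δ₂ : ℝ) (Δ : TorusSite 2 L → ℂ)
    (hΔ : ∀ k, Δ k = ((2 * Δ₁ * (Real.cos (latticeMomentum L k 0) - Real.cos (latticeMomentum L k 1)) : ℝ) : ℂ) -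
        4 * Complex.I * ((Δ₂ * Real.sin (latticeMomentum L k 0) * Real.sin (latticeMomentum L k 1) : ℝ) : ℂ))
    (E : TorusSite 2 L → ℝ) (hEpos : ∀ k, 0 < E k)
    (a : (ℤ × ℤ) →₀ ℂ) (D : ℕ) (hsupp : ∀ ρ ∈ a.support, |ρ.1| ≤ D ∧ |ρ.2| ≤ D) (hL : D + 3 ≤ L)
    (c₀ κ δ : ℝ)
    (hA : ∀ k : TorusSite 2 L, ‖(((E k)⁻¹ : ℝ) : ℂ) -
      ∑ ρ ∈ a.support, a ρ * torusChar (![((ρ.1 : ℤ) : ZMod L), ((ρ.2 : ℤ) : ZMod L)] : TorusSite 2 L) k‖ ≤ δ)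
    (hT : ∀ q : TorusSite 2 L,
      κ * (4 - 2 * Real.cos (latticeMomentum L q 0) - 2 * Real.cos (latticeMomentum L q 1)) ≤
        (∑ r ∈ ({(1, 0), (-1, 0), (0, 1), (0, -1), (1, 1), (-1, -1), (1, -1), (-1, 1)} : Finset (ℤ × ℤ)), ∑ r' ∈ ({(1, 0), (-1, 0), (0, 1), (0, -1), (1, 1), (-1, -1), (1, -1), (-1, 1)} : Finset (ℤ × ℤ)), (fun r : ℤ × ℤ => if (r = (1, 0) ∨ r = (-1, 0)) then (Δ₁ : ℂ) else if (r = (0, 1) ∨ r = (0, -1)) then -(Δ₁ : ℂ)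
          else if (r = (1, 1) ∨ r = (-1, -1)) then Complex.I * (Δ₂ : ℂ) else -(Complex.I * (Δ₂ : ℂ))) r * conj ((fun r : ℤ × ℤ => if (r = (1, 0) ∨ r = (-1, 0)) then (Δ₁ : ℂ) else if (r = (0, 1) ∨ r = (0, -1)) then -(Δ₁ : ℂ)
          else if (r = (1, 1) ∨ r = (-1, -1)) then Complex.I * (Δ₂ : ℂ) else -(Complex.I * (Δ₂ : ℂ))) r') *
          (((3 - Real.cos (r.1 * latticeMomentum L q 0 + r.2 * latticeMomentum L q 1)
            - Real.cos (r'.1 * latticeMomentum L q 0 + r'.2 * latticeMomentum L q 1)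
            - Real.cos ((r.1 - r'.1) * latticeMomentum L q 0 + (r.2 - r'.2) * latticeMomentum L q 1)) / 2 : ℝ) : ℂ) *
          a (r' - r)).re)
    (hκ : 2 * c₀ + 96 * (|Δ₁| + |Δ₂|) ^ 2 * δ ≤ κ) (q : TorusSite 2 L) :
    2 * c₀ * ((L ^ 2 : ℕ) : ℝ) *
        (4 - 2 * Real.cos (latticeMomentum L q 0) - 2 * Real.cos (latticeMomentum L q 1)) ≤
      ∑ k, (2 * ‖Δ k‖ ^ 2 / E k -
        (‖Δ k + Δ (k + q)‖ ^ 2 + ‖Δ k + Δ (k - q)‖ ^ 2) / (4 * E k)) := by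
  have hΔB : ∀ k, Δ k = ∑ r ∈ ({(1, 0), (-1, 0), (0, 1), (0, -1), (1, 1), (-1, -1), (1, -1), (-1, 1)} : Finset (ℤ × ℤ)), (fun r : ℤ × ℤ => if (r = (1, 0) ∨ r = (-1, 0)) then (Δ₁ : ℂ) else if (r = (0, 1) ∨ r = (0, -1)) then -(Δ₁ : ℂ)
          else if (r = (1, 1) ∨ r = (-1, -1)) then Complex.I * (Δ₂ : ℂ) else -(Complex.I * (Δ₂ : ℂ))) r * torusChar (![((r.1 : ℤ) : ZMod L), ((r.2 : ℤ) : ZMod L)] : TorusSite 2 L) k :=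
    fun k => by rw [hΔ k, gap_grid_eq_sum]
  have hκ' : 2 * c₀ + 6 * (∑ r ∈ ({(1, 0), (-1, 0), (0, 1), (0, -1), (1, 1), (-1, -1), (1, -1), (-1, 1)} : Finset (ℤ × ℤ)), ‖(fun r : ℤ × ℤ => if (r = (1, 0) ∨ r = (-1, 0)) then (Δ₁ : ℂ) else if (r = (0, 1) ∨ r = (0, -1)) then -(Δ₁ : ℂ)
          else if (r = (1, 1) ∨ r = (-1, -1)) then Complex.I * (Δ₂ : ℂ) else -(Complex.I * (Δ₂ : ℂ))) r‖) ^ 2 * δ ≤ κ := by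
    rw [sum_norm_bondCoeff]
    have : 6 * (4 * |Δ₁| + 4 * |Δ₂|) ^ 2 * δ = 96 * (|Δ₁| + |Δ₂|) ^ 2 * δ := by ring
    linarith
  exact symbolIneq_of_trigApprox _ bonds_abs_le_one _ Δ hΔB E hEpos a D hsupp hL c₀ κ δ hA hT hκ' q

end BirBdG

end Summit.HubbardSuperconductivity.HubbardSuperconductivity.Theorems

end
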